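/-
Copyright: public-domain mathematics; typed transcription for the H21 Literature library (cell lit-balaban,
reader/typer seat r02 gen 5 = literature-prover-lit-balaban-r02-g5-0).

statement-level skeleton of published theorems with citation tags; proofs where landed; nothing here is a claim about the Yang–Mills mass gap

# Bałaban, *Propagators and renormalization transformations for lattice gauge theories. I*,
# Commun. Math. Phys. **95** (1984) 17–40 — p. 36 «The localized inequalities (1.110)–(1.114) imply immediately the following
# global inequalities» [(1.115)–(1.117)] PROVED for the setting of record `latticeSettingP12 n M a k` (the located leaves `GlobCover`
# constructed, and `B5Global115.global_of_prop12` applied)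

[cite: Balaban1984PropagatorsI]  T. Bałaban, Commun. Math. Phys. 95 (1984) 17–40, p. 36 (PDF p. 20), verbatim (OCR layer of the held scan
`paper:balaban1984-cmp95-propagators-rt-i` p0020.txt, checked against the b2b render p020): «The localized inequalities (1.110)–(1.114)
imply immediately the following global inequalities
  |GJ|, |∇GJ|, |G∇*J|, |ΔGJ|, ‖∇GJ‖_α, ‖G∇*J‖_α ≤ O(1)|J|,   (1.115)
  |∇G∇*J| ≤ O(1)(‖J‖_ε + |J|),   (1.116)
  ‖∇G∇*J‖_α ≤ O(1)(‖J‖_{α+ε} + |J|),   (1.117)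
and (1.89), with the same dependence of the constants O(1).»

WHAT THIS MODULE ADDS (SKELETON row B5.Eq1.117, owner's census; file B after `B5CoverP12Lattice` = file A).  The tree types the passage
as `B5Global115.global_of_prop12 : … GlobCover … → ModelSigns … → hRow … → (B5.Prop12Printed fam → B5.Global115_117Fam fam g)` over the
ABSTRACT carrier, with the located leaves `GlobCover` (pieces `ζ′_{y′}J`, cut-offs `ζ_y`, their (1.108)/(1.109) sizes, subadditivity of the
entries, the passage to the global Hölder norms) as HYPOTHESES (GAPS G-B5-26).  For the SETTING OF RECORD
`B5Prop12FieldsLattice.latticeSettingP12 n M a k` (matrix presentation, `G = (DeltaA n M a)⁻¹`, every `a`) we CONSTRUCT the cover and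
DISCHARGE every field:
* §1 seminorm algebra: `supNorm`/`holderSeminorm` of finite sums (`supNorm_sum_le`, `holderSeminorm_sum_le`), the Hölder product rule with
  a unit-scale Lipschitz weight (`holderSeminormB5_mul_le`: `‖wF‖_ε ≤ ‖F‖_ε + L_w|F|` on pairs `|x − x′| ≤ 1`), the Hölder size of a Lipschitz
  cut-off (`holderSeminormB5_cut_le`);
* §2 linearity of `G`, `∇`, `∇*`, `Δ`, `ζ·` over finite sums and the decompositions `J = Σ_{y′} ζ′_{y′}J` (`sum_pieces_vec`, `sum_pieces_ten`);
* §3 the pieces `pieceL y′ J` (weights `wP` of file A = the printed (1.118) profile squared at unit scale) with `piece_supp`, `piece_sup`,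
  `piece_holder` (`cP = max(1, Lw d)`), the cut-offs `cutP y` with `cut_in`, `cutH_le` (`cζ = Lθ d + 1`);
* §4 the GLOBAL Hölder functionals `gP12` (`B5.GlobalH` of the setting: `‖∇GJ‖_α`/`‖G∇*J‖_α`, `|∇G∇*J|`, `‖∇G∇*J‖_α` as global lattice
  Hölder seminorms / sups) and the passage local → global (`holder_global_of_local`, `cG = 8`: a pair `|x − x′| ≤ ¼` lies in the plateau of
  `ζ_{nearOf x}`, a pair `|x − x′| > ¼` is paid by `2·4^α|f|`);
* §5 **`globCoverP12 : GlobCover (latticeSettingP12 n M a k) (gP12 n M a k) (max 1 (Lw d)) (Lθ d + 1) 8`** and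
  **`global115_117_of_prop12_latticeSettingP12`**: for every family `i ↦ latticeSettingP12 (n i) (M i) (a i) (k i)` of tori of one dimension
  `d` with `≥ 2` unit cubes per direction, `B5.Prop12Printed fam → B5.Global115_117Fam fam gP12` — p. 36 «imply immediately» AS A THEOREM
  for the concrete carrier, by `global_of_prop12` with `ModelSigns` (`B5Ineq110P12Lattice`), `hRow` (`B5RowSumsP12Lattice`) and this cover.

HONEST SCOPE.  (i) Tori with `2 ≤ M μ` (file A).  (ii) `Prop12Printed` for the setting of record is the HYPOTHESIS (three of its ten
entries are proved at `a = 1`: `B5Ineq110P12Lattice`, `B5Ineq114P12Lattice`); this file proves the IMPLICATION of p. 36 only.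
(iii) The global Hölder norms `gP12` are OUR lattice reading of (1.109) for the three fields of `B5.GlobalH` (pairs `|x − x′| ≤ 1`, same
component).  (iv) Constants ours.  Nothing of B5 is used as a hypothesis beyond the displayed implication's antecedent.
(v1.1, QUOTE-AUDIT-B5 item B6 + sweep: guillemets in this file = verbatim print only — the unprinted local-to-global
Hölder step is now in backticks, the header quote ends where print ends («… global inequalities»); one cite tag re-pointed from
the p. 36 sentence about the M₀-cubes □_z to the p. 35 sentence about Δ̃(y); declarations byte-identical.)
-/
import Mathlib
import Literature.MathematicalPhysics.QuantumFieldTheory.Balaban1983to89.B5CoverP12Lattice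
import Literature.MathematicalPhysics.QuantumFieldTheory.Balaban1983to89.B5Global115

open scoped BigOperators Matrix Real
open Finset Matrix

namespace Literature.MathematicalPhysics.QuantumFieldTheory.Balaban1983to89.B5GlobCoverP12Lattice

open Literature.MathematicalPhysics.QuantumFieldTheory.Balaban1983to89
open Literature.MathematicalPhysics.QuantumFieldTheory.Balaban1983to89.B5Prop11Plancherel (Tor fine fdiff)
open Literature.MathematicalPhysics.QuantumFieldTheory.Balaban1983to89.B5Prop11Lower (Lap)
open Literature.MathematicalPhysics.QuantumFieldTheory.Balaban1983to89.B5Prop11Lattice (grad divT)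
open Literature.MathematicalPhysics.QuantumFieldTheory.Balaban1983to89.B5Prop11SettingModel
open Literature.MathematicalPhysics.QuantumFieldTheory.Balaban1983to89.B5Prop12FieldsLattice
open Literature.MathematicalPhysics.QuantumFieldTheory.Balaban1983to89.B5DeltaA169 (DeltaA)
open Literature.MathematicalPhysics.QuantumFieldTheory.Balaban1983to89.LatticeNorms (supNorm supNorm_le norm_le_supNorm
  supNorm_nonneg holderSeminorm holderSeminormB5 holderSeminorm_le holder_bound holderSeminorm_nonneg)
open Literature.MathematicalPhysics.QuantumFieldTheory.Balaban1983to89.B5CoverP12Lattice (wP wP_nonneg wP_le_one sum_wP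
  wP_eq_zero_of_not_mem abs_wP_sub_le Lw Lw_nonneg cutP cutP_nonneg cutP_le_one cutInL_cutP cutSupL_cutP_le_one abs_cutP_sub_le
  Lθ Lθ_nonneg nearOf mem_cubeB_nearOf cutP_nearOf_eq_one_of_distU_le cutP_nearOf_eq_one distU_comm)
open Literature.MathematicalPhysics.QuantumFieldTheory.Balaban1983to89.B5Ineq110P12Lattice (modelSigns_latticeSettingP12)
open Literature.MathematicalPhysics.QuantumFieldTheory.Balaban1983to89.B5RowSumsP12Lattice (hRow_latticeSettingP12)
open Literature.MathematicalPhysics.QuantumFieldTheory.Balaban1983to89.B5Global115 (GlobCover global_of_prop12)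

noncomputable section

variable {d : ℕ}

/-! ## §1 Seminorm algebra: finite sums, the Hölder product rule, Lipschitz cut-offs -/

section Algebra

variable {ι : Type*} {E : Type*} [SeminormedAddCommGroup E]

/-- `‖Σ_k f_k‖_∞ ≤ Σ_k ‖f_k‖_∞` on a finite region. [cite: Balaban1984PropagatorsI, (1.108) p.35] -/
theorem supNorm_sum_le {κ : Type*} (S : Finset ι) (T : Finset κ) (f : κ → ι → E) :
    supNorm S (∑ k ∈ T, f k) ≤ ∑ k ∈ T, supNorm S (f k) :=
  supNorm_le (Finset.sum_nonneg fun k _ => supNorm_nonneg S (f k)) fun x hx => by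
    rw [Finset.sum_apply]
    exact (norm_sum_le _ _).trans (Finset.sum_le_sum fun k _ => norm_le_supNorm (f k) hx)

/-- `‖Σ_k f_k‖_α ≤ Σ_k ‖f_k‖_α` for the plain-difference Hölder seminorms (1.109). [cite: Balaban1984PropagatorsI, (1.109) p.35] -/
theorem holderSeminorm_sum_le {κ : Type*} (α : ℝ) (adm : ι → ι → Prop) (dist : ι → ι → ℝ) (S : Finset ι) (T : Finset κ)
    (f : κ → ι → E) :
    holderSeminorm α adm dist (fun _ _ => id) S (∑ k ∈ T, f k) ≤ ∑ k ∈ T, holderSeminorm α adm dist (fun _ _ => id) S (f k) := by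
  refine holderSeminorm_le (Finset.sum_nonneg fun k _ => holderSeminorm_nonneg _ _ _ _ _ _) fun x hx x' hx' hadm hpos => ?_
  show ‖(∑ k ∈ T, f k) x' - (∑ k ∈ T, f k) x‖ ≤ _
  rw [Finset.sum_apply, Finset.sum_apply, ← Finset.sum_sub_distrib, Finset.sum_mul]
  exact (norm_sum_le _ _).trans (Finset.sum_le_sum fun k _ =>
    holder_bound (α := α) (adm := adm) (dist := dist) (τ := fun _ _ => id) (f k) hx hx' hadm hpos)

variable {M : Fin d → ℕ} {n : ℕ}

/-- for `0 < t ≤ 1` and `s ≤ 1`: `t ≤ t^s` (the unit-scale comparison used for «|x − x′| ≤ 1» pairs). [folklore] -/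
private theorem le_rpow_of_le_one {t s : ℝ} (ht0 : 0 < t) (ht1 : t ≤ 1) (hs : s ≤ 1) : t ≤ t ^ s := by
  have h := Real.rpow_le_rpow_of_exponent_ge ht0 ht1 hs
  rwa [Real.rpow_one] at h

/-- **THE HÖLDER PRODUCT RULE AT UNIT SCALE** (behind `‖ζ′_{y′}J‖_ε ≤ c_P(‖J‖_ε + |J|)`): for a real weight `w` with `0 ≤ w ≤ 1` and
`|w(x) − w(x′)| ≤ L_w|x − x′|`, and any field `F` on an index set fibred over the sites, on admissible pairs with `|x − x′| ≤ 1`: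
`‖wF‖_ε ≤ ‖F‖_ε + L_w·|F|` for `ε ≤ 1`. [cite: Balaban1984PropagatorsI, (1.109) p.35, (1.115)–(1.117) p.36] -/
theorem holderSeminormB5_mul_le [Fintype ι] (site : ι → Tor (fine n M)) (sameDir : ι → ι → Prop) (w : Tor (fine n M) → ℝ)
    {L : ℝ} (hL : 0 ≤ L) (hw0 : ∀ x, 0 ≤ w x) (hw1 : ∀ x, w x ≤ 1)
    (hlip : ∀ x x', |w x - w x'| ≤ L * distU n M x x') (F : ι → ℂ) {ε : ℝ} (hε : ε ≤ 1) :
    holderSeminormB5 ε sameDir (fun p p' => distU n M (site p) (site p')) Finset.univ (fun p => (w (site p) : ℂ) * F p)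
      ≤ holderSeminormB5 ε sameDir (fun p p' => distU n M (site p) (site p')) Finset.univ F + L * supNorm Finset.univ F := by
  set H := holderSeminormB5 ε sameDir (fun p p' => distU n M (site p) (site p')) Finset.univ F with hH
  have hH0 : 0 ≤ H := holderSeminorm_nonneg _ _ _ _ _ _
  have hS0 : 0 ≤ supNorm Finset.univ F := supNorm_nonneg _ _
  unfold holderSeminormB5
  refine holderSeminorm_le (by positivity) fun p _ p' _ hadm hpos => ?_
  obtain ⟨hsd, hle1⟩ := hadm
  set t := distU n M (site p) (site p') with ht
  have htε : t ≤ t ^ ε := le_rpow_of_le_one hpos hle1 hε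
  have htε0 : 0 ≤ t ^ ε := Real.rpow_nonneg hpos.le ε
  have h1 : ‖F p' - F p‖ ≤ H * t ^ ε :=
    holder_bound (α := ε) (adm := fun q q' => sameDir q q' ∧ distU n M (site q) (site q') ≤ 1)
      (dist := fun q q' => distU n M (site q) (site q')) (τ := fun _ _ => id) (S := Finset.univ) F
      (Finset.mem_univ p) (Finset.mem_univ p') ⟨hsd, hle1⟩ hpos
  have h2 : ‖F p‖ ≤ supNorm Finset.univ F := norm_le_supNorm F (Finset.mem_univ p)
  have h3 : |w (site p') - w (site p)| ≤ L * t := by rw [ht, distU_comm]; exact hlip _ _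
  have hw' : |w (site p')| ≤ 1 := by rw [abs_of_nonneg (hw0 _)]; exact hw1 _
  calc ‖id ((w (site p') : ℂ) * F p') - (w (site p) : ℂ) * F p‖
      = ‖(w (site p') : ℂ) * (F p' - F p) + ((w (site p') : ℂ) - w (site p)) * F p‖ := by rw [id]; ring_nf
    _ ≤ ‖(w (site p') : ℂ) * (F p' - F p)‖ + ‖((w (site p') : ℂ) - w (site p)) * F p‖ := norm_add_le _ _
    _ = |w (site p')| * ‖F p' - F p‖ + |w (site p') - w (site p)| * ‖F p‖ := by
        rw [norm_mul, norm_mul, ← Complex.ofReal_sub, Complex.norm_real, Complex.norm_real, Real.norm_eq_abs,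
          Real.norm_eq_abs]
    _ ≤ 1 * (H * t ^ ε) + (L * t) * supNorm Finset.univ F := by gcongr
    _ ≤ 1 * (H * t ^ ε) + (L * t ^ ε) * supNorm Finset.univ F := by gcongr
    _ = (H + L * supNorm Finset.univ F) * t ^ ε := by ring

variable [∀ μ, NeZero (M μ)] [NeZero n]

/-- **THE HÖLDER SIZE OF A LIPSCHITZ CUT-OFF**: `|ζ(x) − ζ(x′)| ≤ L|x − x′|` gives `‖ζ‖_α ≤ L` on pairs `|x − x′| ≤ 1`, for `α ≤ 1`.
[cite: Balaban1984PropagatorsI, Prop. 1.2 (1.111) p.35 (‖ζ‖_α)] -/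
theorem holderSeminormB5_cut_le (ζ : Tor (fine n M) → ℝ) {L : ℝ} (hL : 0 ≤ L)
    (hlip : ∀ x x', |ζ x - ζ x'| ≤ L * distU n M x x') {α : ℝ} (hα : α ≤ 1) :
    holderSeminormB5 α (fun _ _ => True) (distU n M) Finset.univ ζ ≤ L := by
  unfold holderSeminormB5
  refine holderSeminorm_le hL fun x _ x' _ hadm hpos => ?_
  obtain ⟨-, hle1⟩ := hadm
  have htα : distU n M x x' ≤ distU n M x x' ^ α := le_rpow_of_le_one hpos hle1 hα
  calc ‖id (ζ x') - ζ x‖ = |ζ x' - ζ x| := by rw [id, Real.norm_eq_abs]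
    _ ≤ L * distU n M x' x := hlip _ _
    _ = L * distU n M x x' := by rw [distU_comm]
    _ ≤ L * distU n M x x' ^ α := mul_le_mul_of_nonneg_left htα hL

end Algebra

/-! ## §2 Linearity of `G`, `∇`, `∇*`, `Δ`, `ζ·` over finite sums; the decompositions `J = Σ_{y′} ζ′_{y′}J` -/

section Linear

variable (M : Fin d → ℕ) [hM : ∀ μ, NeZero (M μ)] (n : ℕ) [NeZero n]

/-- `A(Σ_i v_i) = Σ_i Av_i`. [folklore] -/
private theorem mulVec_finset_sum {m m' : Type*} [Fintype m] [Fintype m'] {κ : Type*} (A : Matrix m' m ℂ) (s : Finset κ)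
    (v : κ → m → ℂ) : A *ᵥ (∑ i ∈ s, v i) = ∑ i ∈ s, A *ᵥ v i := by
  have h := map_sum (Matrix.mulVecLin A) v s
  simp only [Matrix.mulVecLin_apply] at h
  exact h

/-- `∇(Σ_i B_i) = Σ_i ∇B_i`. [cite: Balaban1984PropagatorsI, (1.31) p.23] -/
theorem grad_sum {κ : Type*} (s : Finset κ) (B : κ → Tor (fine n M) × Fin d → ℂ) :
    grad n M (∑ i ∈ s, B i) = ∑ i ∈ s, grad n M (B i) := by
  funext ν
  rw [Finset.sum_apply]
  exact mulVec_finset_sum _ s B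

/-- `∇*(Σ_i J_i) = Σ_i ∇*J_i`. [cite: Balaban1984PropagatorsI, (1.89) p.33 (∇*)] -/
theorem divT_sum {κ : Type*} (s : Finset κ) (J : κ → Fin d → (Tor (fine n M) × Fin d → ℂ)) :
    divT n M (∑ i ∈ s, J i) = ∑ i ∈ s, divT n M (J i) := by
  unfold divT
  rw [Finset.sum_comm]
  refine Finset.sum_congr rfl fun ν _ => ?_
  rw [Finset.sum_apply]
  exact mulVec_finset_sum _ s (fun i => J i ν)

omit hM [NeZero n] in
/-- `ζ(Σ_i v_i) = Σ_i ζv_i` (vector fields). [cite: Balaban1984PropagatorsI, Prop. 1.2 (1.111) p.35] -/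
theorem smulV_sum {κ : Type*} (ζ : Tor (fine n M) → ℝ) (s : Finset κ) (v : κ → Tor (fine n M) × Fin d → ℂ) :
    smulV n M ζ (∑ i ∈ s, v i) = ∑ i ∈ s, smulV n M ζ (v i) := by
  funext b
  simp only [smulV, Finset.sum_apply, Finset.mul_sum]

omit hM [NeZero n] in
/-- `ζ(Σ_i F_i) = Σ_i ζF_i` (tensor fields). [cite: Balaban1984PropagatorsI, Prop. 1.2 (1.111) p.35] -/
theorem smulT_sum {S : Type*} {κ : Type*} (ζ : Tor (fine n M) → ℝ) (s : Finset κ)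
    (F : κ → S → (Tor (fine n M) × Fin d → ℂ)) :
    smulT n M ζ (∑ i ∈ s, F i) = ∑ i ∈ s, smulT n M ζ (F i) := by
  funext t b
  simp only [smulT, Finset.sum_apply, Finset.mul_sum]

/-- flattening a tensor field to a function of the pair index. [cite: Balaban1984PropagatorsI, (1.108) p.35 (max over indices)] -/
def flat {S : Type*} (F : S → (Tor (fine n M) × Fin d → ℂ)) : S × (Tor (fine n M) × Fin d) → ℂ := fun p => F p.1 p.2

omit hM [NeZero n] in
/-- flattening commutes with finite sums (plumbing for the flattened (1.108)/(1.109) norms of tensor fields). [cite: Balaban1984PropagatorsI, (1.108) p.35] -/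
theorem flat_sum {S : Type*} {κ : Type*} (s : Finset κ) (F : κ → S → (Tor (fine n M) × Fin d → ℂ)) :
    flat M n (∑ i ∈ s, F i) = ∑ i ∈ s, flat M n (F i) := by
  funext p
  simp only [flat, Finset.sum_apply]

omit [NeZero n] in
/-- **`J = Σ_{y′∈T₁} ζ′_{y′}J` for vector fields** (`ζ′_{y′} = wP y′`, `Σ wP = 1`). [cite: Balaban1984PropagatorsI, (1.118) p.36 («Σ_z h_z² = 1»), (1.115)–(1.117) p.36] -/
theorem sum_pieces_vec (hM2 : ∀ μ, 2 ≤ M μ) (J : Tor (fine n M) × Fin d → ℂ) :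
    ∑ y' : Tor M, smulV n M (wP M n y') J = J := by
  funext b
  rw [Finset.sum_apply]
  simp only [smulV]
  rw [← Finset.sum_mul, ← Complex.ofReal_sum, sum_wP M n hM2 b.1, Complex.ofReal_one, one_mul]

omit [NeZero n] in
/-- **`J = Σ_{y′∈T₁} ζ′_{y′}J` for tensor fields**. [cite: Balaban1984PropagatorsI, (1.118) p.36, (1.115)–(1.117) p.36] -/
theorem sum_pieces_ten (hM2 : ∀ μ, 2 ≤ M μ) {S : Type*} (J : S → (Tor (fine n M) × Fin d → ℂ)) :
    ∑ y' : Tor M, smulT n M (wP M n y') J = J := by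
  funext t b
  rw [Finset.sum_apply, Finset.sum_apply]
  simp only [smulT]
  rw [← Finset.sum_mul, ← Complex.ofReal_sum, sum_wP M n hM2 b.1, Complex.ofReal_one, one_mul]

end Linear

/-! ## §3 The pieces and the cut-offs of the cover, with their (1.108)/(1.109) sizes -/

section Pieces

variable (M : Fin d → ℕ) [hM : ∀ μ, NeZero (M μ)] (n : ℕ) [NeZero n] (a : ℝ)

/-- **the pieces `ζ′_{y′}J`** of a located argument: multiplication by the unit-scale partition weight `wP y′` (file A), summand by
summand. [cite: Balaban1984PropagatorsI, (1.115)–(1.117) p.36 («immediately»: decomposition of J over the cubes Δ̃(y′))] -/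
def pieceL (y' : Tor M) : Loc189 n M → Loc189 n M
  | .vec J => .vec (smulV n M (wP M n y') J)
  | .ten J => .ten (smulT n M (wP M n y') J)
  | .ten2 J => .ten2 (smulT n M (wP M n y') J)

/-- **`supp ζ′_{y′}J ⊂ Δ̃(y′)`**. [cite: Balaban1984PropagatorsI, (1.115)–(1.117) p.36, p.35 (Δ̃(y′))] -/
theorem piece_supp (y' : Tor M) (J : Loc189 n M) : suppInL n M (pieceL M n y' J) y' := by
  have hn : 1 ≤ n := Nat.one_le_iff_ne_zero.mpr (NeZero.ne n)
  have key : ∀ (b : Tor (fine n M) × Fin d) (z : ℂ), (wP M n y' b.1 : ℂ) * z ≠ 0 → b.1 ∈ cubeT n M y' := by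
    intro b z h
    by_contra hb
    exact h (by rw [wP_eq_zero_of_not_mem M n hn hb, Complex.ofReal_zero, zero_mul])
  cases J with
  | vec J => exact fun b hb => key b (J b) hb
  | ten J => exact fun ν b hb => key b (J ν b) hb
  | ten2 J => exact fun p b hb => key b (J p b) hb

omit [NeZero n] in
/-- pointwise `|wP·z| ≤ |z|`. [cite: Balaban1984PropagatorsI, (1.118) p.36 (0 ≤ h ≤ 1)] -/
private theorem norm_wP_mul_le (y' : Tor M) (x : Tor (fine n M)) (z : ℂ) : ‖(wP M n y' x : ℂ) * z‖ ≤ ‖z‖ := by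
  rw [norm_mul, Complex.norm_real, Real.norm_eq_abs, abs_of_nonneg (wP_nonneg M n y' x)]
  exact (mul_le_mul_of_nonneg_right (wP_le_one M n y' x) (norm_nonneg z)).trans (one_mul _).le

/-- **`|ζ′_{y′}J| ≤ |J|`**. [cite: Balaban1984PropagatorsI, (1.108) p.35, (1.115)–(1.117) p.36] -/
theorem piece_sup (y' : Tor M) (J : Loc189 n M) : supNormL n M (pieceL M n y' J) ≤ supNormL n M J := by
  cases J with
  | vec J =>
      exact supNorm_le (supNorm_nonneg _ _) fun b hb =>
        (norm_wP_mul_le M n y' b.1 (J b)).trans (norm_le_supNorm J hb)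
  | ten J =>
      exact supNorm_le (supNorm_nonneg _ _) fun p hp =>
        (norm_wP_mul_le M n y' p.2.1 (J p.1 p.2)).trans
          (norm_le_supNorm (fun p : Fin d × (Tor (fine n M) × Fin d) => J p.1 p.2) hp)
  | ten2 J =>
      exact supNorm_le (supNorm_nonneg _ _) fun p hp =>
        (norm_wP_mul_le M n y' p.2.1 (J p.1 p.2)).trans
          (norm_le_supNorm (fun p : (Fin d × Fin d) × (Tor (fine n M) × Fin d) => J p.1 p.2) hp)

/-- **`‖ζ′_{y′}J‖_ε ≤ c_P(‖J‖_ε + |J|)`** with `c_P = max(1, Lw d)`, for `0 < ε < 1` (tori with `≥ 2` unit cubes per direction).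
[cite: Balaban1984PropagatorsI, (1.109) p.35, (1.115)–(1.117) p.36] -/
theorem piece_holder (hM2 : ∀ μ, 2 ≤ M μ) (ε : ℝ) (J : Loc189 n M) (y' : Tor M) (hε0 : 0 < ε) (hε1 : ε < 1) :
    holderL n M ε (pieceL M n y' J) ≤ max 1 (Lw d) * (holderL n M ε J + supNormL n M J) := by
  have hn : 1 ≤ n := Nat.one_le_iff_ne_zero.mpr (NeZero.ne n)
  have hL := Lw_nonneg d
  have hlip := abs_wP_sub_le M n hn hM2 y'
  have hmax1 : (1 : ℝ) ≤ max 1 (Lw d) := le_max_left _ _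
  have hmax2 : Lw d ≤ max 1 (Lw d) := le_max_right _ _
  have fin : ∀ {H S : ℝ}, 0 ≤ H → 0 ≤ S → H + Lw d * S ≤ max 1 (Lw d) * (H + S) := by
    intro H S hH hS
    nlinarith
  cases J with
  | vec J =>
      have h := holderSeminormB5_mul_le (site := fun b : Tor (fine n M) × Fin d => b.1) (fun b b' => b.2 = b'.2)
        (wP M n y') hL (wP_nonneg M n y') (wP_le_one M n y') hlip J hε1.le
      exact h.trans (fin (holderSeminorm_nonneg _ _ _ _ _ _) (supNorm_nonneg _ _))
  | ten J =>
      have h := holderSeminormB5_mul_le (site := fun p : Fin d × (Tor (fine n M) × Fin d) => p.2.1)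
        (fun p p' => p.1 = p'.1 ∧ p.2.2 = p'.2.2) (wP M n y') hL (wP_nonneg M n y') (wP_le_one M n y') hlip
        (fun p => J p.1 p.2) hε1.le
      exact h.trans (fin (holderSeminorm_nonneg _ _ _ _ _ _) (supNorm_nonneg _ _))
  | ten2 J =>
      have h := holderSeminormB5_mul_le (site := fun p : (Fin d × Fin d) × (Tor (fine n M) × Fin d) => p.2.1)
        (fun p p' => p.1 = p'.1 ∧ p.2.2 = p'.2.2) (wP M n y') hL (wP_nonneg M n y') (wP_le_one M n y') hlip
        (fun p => J p.1 p.2) hε1.le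
      exact h.trans (fin (holderSeminorm_nonneg _ _ _ _ _ _) (supNorm_nonneg _ _))

/-- **`‖ζ_y‖_α + |ζ_y| ≤ c_ζ = Lθ d + 1`** for the plateau cut-offs of file A, `0 ≤ α < 1` (tori with `≥ 2` unit cubes per direction).
[cite: Balaban1984PropagatorsI, Prop. 1.2 (1.111) p.35 (‖ζ‖_α + |ζ|)] -/
theorem cutH_le (hM2 : ∀ μ, 2 ≤ M μ) (α : ℝ) (y : Tor M) (hα1 : α < 1) :
    cutHL n M α (cutP M n y) ≤ Lθ d + 1 := by
  have hn : 1 ≤ n := Nat.one_le_iff_ne_zero.mpr (NeZero.ne n)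
  unfold cutHL
  exact add_le_add (holderSeminormB5_cut_le (cutP M n y) (Lθ_nonneg d) (abs_cutP_sub_le M n hn hM2 y) hα1.le)
    (cutSupL_cutP_le_one M n y)

end Pieces

/-! ## §4 The global Hölder functionals of the setting and the passage local → global -/

section Global

variable (M : Fin d → ℕ) [hM : ∀ μ, NeZero (M μ)] (n : ℕ) [NeZero n] (a : ℝ)

/-- `‖∇GJ‖_α` (vector-field summand) / `‖G∇*J‖_α` (tensor summand), GLOBAL. [cite: Balaban1984PropagatorsI, (1.115) p.36, (1.109) p.35] -/
def hg1L : Loc189 n M → ℝ → ℝ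
  | .vec J, α => holderT n M α (grad n M ((DeltaA n M a)⁻¹ *ᵥ J))
  | .ten J, α => holderV n M α ((DeltaA n M a)⁻¹ *ᵥ divT n M J)
  | .ten2 _, _ => 0

/-- `|∇G∇*J|`, GLOBAL sup (tensor summand). [cite: Balaban1984PropagatorsI, (1.116) p.36, (1.108) p.35] -/
def e4gL : Loc189 n M → ℝ
  | .ten J => supNorm Finset.univ
      (fun p : Fin d × (Tor (fine n M) × Fin d) => grad n M ((DeltaA n M a)⁻¹ *ᵥ divT n M J) p.1 p.2)
  | .vec _ => 0
  | .ten2 _ => 0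

/-- `‖∇G∇*J‖_α`, GLOBAL (tensor summand). [cite: Balaban1984PropagatorsI, (1.117) p.36, (1.109) p.35] -/
def hg2L : Loc189 n M → ℝ → ℝ
  | .ten J, α => holderT n M α (grad n M ((DeltaA n M a)⁻¹ *ᵥ divT n M J))
  | .vec _, _ => 0
  | .ten2 _, _ => 0

/-- **THE GLOBAL HÖLDER FUNCTIONALS `B5.GlobalH` OF THE SETTING OF RECORD** (`hg1 = ‖∇GJ‖_α / ‖G∇*J‖_α`, `e4g = |∇G∇*J|`,
`hg2 = ‖∇G∇*J‖_α`, global lattice versions of (1.108)/(1.109)). [cite: Balaban1984PropagatorsI, (1.115)–(1.117) p.36] -/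
def gP12 (k : ℕ) : B5.GlobalH (latticeSettingP12 n M a k) where
  hg1 := hg1L M n a
  e4g := e4gL M n a
  hg2 := hg2L M n a

/-- **THE PASSAGE LOCAL → GLOBAL FOR A HÖLDER SEMINORM** (`‖f‖_α ≤ O(1)(sup_y ‖ζ_yf‖_α + |f|)`, the unprinted step — ours —
that p. 36 «immediately» hides): if every cut-off product `ζ_yF` has
Hölder seminorm `≤ B` and `|F| ≤ B′` pointwise, then `‖F‖_α ≤ 8(B + B′)` (`0 ≤ α < 1`): a pair `|x − x′| ≤ ¼` lies in the plateau of
`ζ_{nearOf x}` (file A), a pair `¼ < |x − x′| ≤ 1` is paid by `2|F| ≤ 8B′|x − x′|^α`. [cite: Balaban1984PropagatorsI, (1.115)–(1.117) p.36, (1.109) p.35] -/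
theorem holder_global_of_local {ι : Type*} [Fintype ι] (site : ι → Tor (fine n M)) (sameDir : ι → ι → Prop) (F : ι → ℂ)
    {α B B' : ℝ} (hα1 : α < 1) (hB : 0 ≤ B) (hB' : 0 ≤ B')
    (hloc : ∀ y : Tor M, holderSeminormB5 α sameDir (fun p p' => distU n M (site p) (site p')) Finset.univ
      (fun p => (cutP M n y (site p) : ℂ) * F p) ≤ B)
    (hsup : ∀ p, ‖F p‖ ≤ B') :
    holderSeminormB5 α sameDir (fun p p' => distU n M (site p) (site p')) Finset.univ F ≤ 8 * (B + B') := by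
  have hn : 1 ≤ n := Nat.one_le_iff_ne_zero.mpr (NeZero.ne n)
  unfold holderSeminormB5
  refine holderSeminorm_le (by positivity) fun p _ p' _ hadm hpos => ?_
  obtain ⟨hsd, hle1⟩ := hadm
  set t := distU n M (site p) (site p') with ht
  have htα0 : 0 ≤ t ^ α := Real.rpow_nonneg hpos.le α
  have htα : t ≤ t ^ α := le_rpow_of_le_one hpos hle1 hα1.le
  rw [id]
  by_cases hq : t ≤ 1 / 4
  · -- inside the plateau of ζ_{nearOf x}
    set y := nearOf M n (site p) with hy
    have h1 : cutP M n y (site p) = 1 := cutP_nearOf_eq_one M n hn (site p)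
    have h2 : cutP M n y (site p') = 1 := cutP_nearOf_eq_one_of_distU_le M n hn hq
    have hb := holder_bound (α := α) (adm := fun q q' => sameDir q q' ∧ distU n M (site q) (site q') ≤ 1)
      (dist := fun q q' => distU n M (site q) (site q')) (τ := fun _ _ => id) (S := Finset.univ)
      (fun q => (cutP M n y (site q) : ℂ) * F q) (Finset.mem_univ p) (Finset.mem_univ p') ⟨hsd, hle1⟩ hpos
    rw [id, h1, h2, Complex.ofReal_one, one_mul, one_mul] at hb
    calc ‖F p' - F p‖ ≤ holderSeminorm α (fun q q' => sameDir q q' ∧ distU n M (site q) (site q') ≤ 1)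
          (fun q q' => distU n M (site q) (site q')) (fun _ _ => id) Finset.univ
          (fun q => (cutP M n y (site q) : ℂ) * F q) * t ^ α := hb
      _ ≤ B * t ^ α := mul_le_mul_of_nonneg_right (hloc y) htα0
      _ ≤ 8 * (B + B') * t ^ α := by
          apply mul_le_mul_of_nonneg_right _ htα0
          linarith
  · -- far pairs are paid by |F|
    have hq' : 1 / 4 < t := not_le.mp hq
    have h4 : 1 ≤ 4 * t ^ α := by linarith
    calc ‖F p' - F p‖ ≤ ‖F p'‖ + ‖F p‖ := norm_sub_le _ _
      _ ≤ B' + B' := add_le_add (hsup p') (hsup p)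
      _ = 2 * B' := by ring
      _ ≤ 2 * B' * (4 * t ^ α) := by nlinarith
      _ = 8 * B' * t ^ α := by ring
      _ ≤ 8 * (B + B') * t ^ α := by
          apply mul_le_mul_of_nonneg_right _ htα0
          linarith

/-- a pointwise bound from the localized sups: every index lies over a site of some `Δ̃(y)` (namely `y = nearOf x`; the
cubes Δ̃(y) cover T_η — print's «These cubes cover the lattice» is said of the M₀-cubes □_z, p. 36 L29; v1.0 cited it here).
[cite: Balaban1984PropagatorsI, p. 35 L27–29 («Cubes Δ̃(y) are sums of 2^d unit cubes having the point y as a corner,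
thus they are cubes of size 2 and with a center at y.»), (1.108) p.35] -/
theorem norm_le_of_cube_sups (F : Tor (fine n M) × Fin d → ℂ) {B : ℝ}
    (h : ∀ y : Tor M, supNorm (cubeB n M y) F ≤ B) (b : Tor (fine n M) × Fin d) : ‖F b‖ ≤ B := by
  have hn : 1 ≤ n := Nat.one_le_iff_ne_zero.mpr (NeZero.ne n)
  exact (norm_le_supNorm F (mem_cubeB_nearOf M n hn b)).trans (h _)

/-- the same for flattened tensor fields over `univ ×ˢ cubeB y`. [cite: Balaban1984PropagatorsI, p.35, (1.108) p.35] -/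
theorem norm_le_of_cube_sups_flat {S : Type*} [Fintype S] (F : S × (Tor (fine n M) × Fin d) → ℂ) {B : ℝ}
    (h : ∀ y : Tor M, supNorm (Finset.univ ×ˢ cubeB n M y) F ≤ B) (p : S × (Tor (fine n M) × Fin d)) : ‖F p‖ ≤ B := by
  have hn : 1 ≤ n := Nat.one_le_iff_ne_zero.mpr (NeZero.ne n)
  have hp : p ∈ Finset.univ ×ˢ cubeB n M (nearOf M n p.2.1) :=
    Finset.mem_product.mpr ⟨Finset.mem_univ _, mem_cubeB_nearOf M n hn p.2⟩
  exact (norm_le_supNorm F hp).trans (h _)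

end Global

/-! ## §5 The cover `GlobCover` of the setting of record and p. 36 «imply immediately» as a theorem -/

section Cover

variable (M : Fin d → ℕ) [hM : ∀ μ, NeZero (M μ)] (n : ℕ) [NeZero n] (a : ℝ)

/-- **THE LOCATED LEAVES `GlobCover` (G-B5-26) CONSTRUCTED FOR THE SETTING OF RECORD**: index set `T₁ = Tor M` (all unit-lattice points),
pieces `ζ′_{y′}J = wP y′ · J` (printed (1.118) profile squared at unit scale), cut-offs `ζ_y = cutP y`; constants `c_P = max(1, Lw d)`,
`c_ζ = Lθ d + 1`, `c_G = 8`; every field PROVED (tori with `≥ 2` unit cubes per direction, any `a`).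
[cite: Balaban1984PropagatorsI, (1.115)–(1.117) p.36] -/
def globCoverP12 (hM2 : ∀ μ, 2 ≤ M μ) (k : ℕ) :
    GlobCover (latticeSettingP12 n M a k) (gP12 M n a k) (max 1 (Lw d)) (Lθ d + 1) 8 where
  T1 := (Finset.univ : Finset (Tor M))
  piece := fun J y' => pieceL M n y' J
  cut := fun y => cutP M n y
  piece_supp := fun J y' => piece_supp M n y' J
  cut_in := fun y => cutInL_cutP M n (Nat.one_le_iff_ne_zero.mpr (NeZero.ne n)) y
  piece_sup := fun J y' => piece_sup M n y' J
  piece_holder := fun ε J y' hε0 hε1 => piece_holder M n hM2 ε J y' hε0 hε1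
  cutH_le := fun α y _ hα1 => cutH_le M n hM2 α y hα1
  e_sub := by
    intro m J y
    change eL n M a m J y ≤ ∑ y' : Tor M, eL n M a m (pieceL M n y' J) y
    cases J with
    | vec J =>
        fin_cases m
        · -- |GJ|
          change supNorm (cubeB n M y) ((DeltaA n M a)⁻¹ *ᵥ J)
            ≤ ∑ y' : Tor M, supNorm (cubeB n M y) ((DeltaA n M a)⁻¹ *ᵥ smulV n M (wP M n y') J)
          calc supNorm (cubeB n M y) ((DeltaA n M a)⁻¹ *ᵥ J)
              = supNorm (cubeB n M y) (∑ y' : Tor M, (DeltaA n M a)⁻¹ *ᵥ smulV n M (wP M n y') J) := by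
                rw [← mulVec_finset_sum, sum_pieces_vec M n hM2]
            _ ≤ _ := supNorm_sum_le _ _ _
        · -- |∇GJ|
          change supNorm (Finset.univ ×ˢ cubeB n M y) (flat M n (grad n M ((DeltaA n M a)⁻¹ *ᵥ J)))
            ≤ ∑ y' : Tor M, supNorm (Finset.univ ×ˢ cubeB n M y)
              (flat M n (grad n M ((DeltaA n M a)⁻¹ *ᵥ smulV n M (wP M n y') J)))
          calc supNorm (Finset.univ ×ˢ cubeB n M y) (flat M n (grad n M ((DeltaA n M a)⁻¹ *ᵥ J)))
              = supNorm (Finset.univ ×ˢ cubeB n M y)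
                  (∑ y' : Tor M, flat M n (grad n M ((DeltaA n M a)⁻¹ *ᵥ smulV n M (wP M n y') J))) := by
                rw [← flat_sum, ← grad_sum, ← mulVec_finset_sum, sum_pieces_vec M n hM2]
            _ ≤ _ := supNorm_sum_le _ _ _
        · -- no content on this summand
          change (0 : ℝ) ≤ ∑ y' : Tor M, (0 : ℝ)
          simp
        · -- |ΔGJ|
          change supNorm (cubeB n M y) (Lap n M *ᵥ ((DeltaA n M a)⁻¹ *ᵥ J))
            ≤ ∑ y' : Tor M, supNorm (cubeB n M y) (Lap n M *ᵥ ((DeltaA n M a)⁻¹ *ᵥ smulV n M (wP M n y') J))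
          calc supNorm (cubeB n M y) (Lap n M *ᵥ ((DeltaA n M a)⁻¹ *ᵥ J))
              = supNorm (cubeB n M y) (∑ y' : Tor M, Lap n M *ᵥ ((DeltaA n M a)⁻¹ *ᵥ smulV n M (wP M n y') J)) := by
                rw [← mulVec_finset_sum, ← mulVec_finset_sum, sum_pieces_vec M n hM2]
            _ ≤ _ := supNorm_sum_le _ _ _
    | ten J =>
        fin_cases m
        · change (0 : ℝ) ≤ ∑ y' : Tor M, (0 : ℝ)
          simp
        · change (0 : ℝ) ≤ ∑ y' : Tor M, (0 : ℝ)
          simp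
        · -- |G∇*J|
          change supNorm (cubeB n M y) ((DeltaA n M a)⁻¹ *ᵥ divT n M J)
            ≤ ∑ y' : Tor M, supNorm (cubeB n M y) ((DeltaA n M a)⁻¹ *ᵥ divT n M (smulT n M (wP M n y') J))
          calc supNorm (cubeB n M y) ((DeltaA n M a)⁻¹ *ᵥ divT n M J)
              = supNorm (cubeB n M y) (∑ y' : Tor M, (DeltaA n M a)⁻¹ *ᵥ divT n M (smulT n M (wP M n y') J)) := by
                rw [← mulVec_finset_sum, ← divT_sum, sum_pieces_ten M n hM2]
            _ ≤ _ := supNorm_sum_le _ _ _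
        · change (0 : ℝ) ≤ ∑ y' : Tor M, (0 : ℝ)
          simp
    | ten2 J =>
        fin_cases m <;>
        · change (0 : ℝ) ≤ ∑ y' : Tor M, (0 : ℝ)
          simp
  h1_sub := by
    intro J α y hα0 hα1
    change h1L n M a J α (cutP M n y) ≤ ∑ y' : Tor M, h1L n M a (pieceL M n y' J) α (cutP M n y)
    cases J with
    | vec J =>
        change holderT n M α (smulT n M (cutP M n y) (grad n M ((DeltaA n M a)⁻¹ *ᵥ J)))
          ≤ ∑ y' : Tor M, holderT n M α (smulT n M (cutP M n y) (grad n M ((DeltaA n M a)⁻¹ *ᵥ smulV n M (wP M n y') J)))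
        unfold holderT holderSeminormB5
        have e : (fun p : Fin d × (Tor (fine n M) × Fin d) => smulT n M (cutP M n y) (grad n M ((DeltaA n M a)⁻¹ *ᵥ J)) p.1 p.2)
            = ∑ y' : Tor M, (fun p : Fin d × (Tor (fine n M) × Fin d) =>
                smulT n M (cutP M n y) (grad n M ((DeltaA n M a)⁻¹ *ᵥ smulV n M (wP M n y') J)) p.1 p.2) := by
          change flat M n (smulT n M (cutP M n y) (grad n M ((DeltaA n M a)⁻¹ *ᵥ J)))
            = ∑ y' : Tor M, flat M n (smulT n M (cutP M n y) (grad n M ((DeltaA n M a)⁻¹ *ᵥ smulV n M (wP M n y') J)))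
          rw [← flat_sum, ← smulT_sum, ← grad_sum, ← mulVec_finset_sum, sum_pieces_vec M n hM2]
        rw [e]
        exact holderSeminorm_sum_le _ _ _ _ _ _
    | ten J =>
        change holderV n M α (smulV n M (cutP M n y) ((DeltaA n M a)⁻¹ *ᵥ divT n M J))
          ≤ ∑ y' : Tor M, holderV n M α (smulV n M (cutP M n y) ((DeltaA n M a)⁻¹ *ᵥ divT n M (smulT n M (wP M n y') J)))
        unfold holderV holderSeminormB5
        rw [show smulV n M (cutP M n y) ((DeltaA n M a)⁻¹ *ᵥ divT n M J)
            = ∑ y' : Tor M, smulV n M (cutP M n y) ((DeltaA n M a)⁻¹ *ᵥ divT n M (smulT n M (wP M n y') J)) by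
          rw [← smulV_sum, ← mulVec_finset_sum, ← divT_sum, sum_pieces_ten M n hM2]]
        exact holderSeminorm_sum_le _ _ _ _ _ _
    | ten2 J =>
        change (0 : ℝ) ≤ ∑ y' : Tor M, (0 : ℝ)
        simp
  e4_sub := by
    intro J y
    change e4L n M a J y ≤ ∑ y' : Tor M, e4L n M a (pieceL M n y' J) y
    cases J with
    | ten J =>
        change supNorm (Finset.univ ×ˢ cubeB n M y) (flat M n (grad n M ((DeltaA n M a)⁻¹ *ᵥ divT n M J)))
          ≤ ∑ y' : Tor M, supNorm (Finset.univ ×ˢ cubeB n M y)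
            (flat M n (grad n M ((DeltaA n M a)⁻¹ *ᵥ divT n M (smulT n M (wP M n y') J))))
        calc supNorm (Finset.univ ×ˢ cubeB n M y) (flat M n (grad n M ((DeltaA n M a)⁻¹ *ᵥ divT n M J)))
            = supNorm (Finset.univ ×ˢ cubeB n M y)
                (∑ y' : Tor M, flat M n (grad n M ((DeltaA n M a)⁻¹ *ᵥ divT n M (smulT n M (wP M n y') J)))) := by
              rw [← flat_sum, ← grad_sum, ← mulVec_finset_sum, ← divT_sum, sum_pieces_ten M n hM2]
          _ ≤ _ := supNorm_sum_le _ _ _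
    | vec J =>
        change (0 : ℝ) ≤ ∑ y' : Tor M, (0 : ℝ)
        simp
    | ten2 J =>
        change (0 : ℝ) ≤ ∑ y' : Tor M, (0 : ℝ)
        simp
  h2_sub := by
    intro J α y hα0 hα1
    change h2L n M a J α (cutP M n y) ≤ ∑ y' : Tor M, h2L n M a (pieceL M n y' J) α (cutP M n y)
    cases J with
    | ten J =>
        change holderT n M α (smulT n M (cutP M n y) (grad n M ((DeltaA n M a)⁻¹ *ᵥ divT n M J)))
          ≤ ∑ y' : Tor M, holderT n M α
            (smulT n M (cutP M n y) (grad n M ((DeltaA n M a)⁻¹ *ᵥ divT n M (smulT n M (wP M n y') J))))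
        unfold holderT holderSeminormB5
        have e : (fun p : Fin d × (Tor (fine n M) × Fin d) =>
              smulT n M (cutP M n y) (grad n M ((DeltaA n M a)⁻¹ *ᵥ divT n M J)) p.1 p.2)
            = ∑ y' : Tor M, (fun p : Fin d × (Tor (fine n M) × Fin d) =>
                smulT n M (cutP M n y) (grad n M ((DeltaA n M a)⁻¹ *ᵥ divT n M (smulT n M (wP M n y') J))) p.1 p.2) := by
          change flat M n (smulT n M (cutP M n y) (grad n M ((DeltaA n M a)⁻¹ *ᵥ divT n M J)))
            = ∑ y' : Tor M, flat M n (smulT n M (cutP M n y) (grad n M ((DeltaA n M a)⁻¹ *ᵥ divT n M (smulT n M (wP M n y') J))))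
          rw [← flat_sum, ← smulT_sum, ← grad_sum, ← mulVec_finset_sum, ← divT_sum, sum_pieces_ten M n hM2]
        rw [e]
        exact holderSeminorm_sum_le _ _ _ _ _ _
    | vec J =>
        change (0 : ℝ) ≤ ∑ y' : Tor M, (0 : ℝ)
        simp
    | ten2 J =>
        change (0 : ℝ) ≤ ∑ y' : Tor M, (0 : ℝ)
        simp
  hg1_le := by
    intro J α B B' hα0 hα1 hB hB' hh1 he
    change hg1L M n a J α ≤ 8 * (B + B')
    cases J with
    | vec J =>
        change holderT n M α (grad n M ((DeltaA n M a)⁻¹ *ᵥ J)) ≤ 8 * (B + B')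
        refine holder_global_of_local M n (site := fun p : Fin d × (Tor (fine n M) × Fin d) => p.2.1)
          (sameDir := fun p p' => p.1 = p'.1 ∧ p.2.2 = p'.2.2)
          (F := fun p => grad n M ((DeltaA n M a)⁻¹ *ᵥ J) p.1 p.2) hα1 hB hB' (fun y' => hh1 y') fun p => ?_
        exact norm_le_of_cube_sups_flat M n (fun p : Fin d × (Tor (fine n M) × Fin d) =>
          grad n M ((DeltaA n M a)⁻¹ *ᵥ J) p.1 p.2) (fun y' => he 1 y') p
    | ten J =>
        change holderV n M α ((DeltaA n M a)⁻¹ *ᵥ divT n M J) ≤ 8 * (B + B')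
        refine holder_global_of_local M n (site := fun b : Tor (fine n M) × Fin d => b.1)
          (sameDir := fun b b' => b.2 = b'.2)
          (F := (DeltaA n M a)⁻¹ *ᵥ divT n M J) hα1 hB hB' (fun y' => hh1 y') fun b => ?_
        exact norm_le_of_cube_sups M n ((DeltaA n M a)⁻¹ *ᵥ divT n M J) (fun y' => he 2 y') b
    | ten2 J =>
        change (0 : ℝ) ≤ 8 * (B + B')
        positivity
  e4g_le := by
    intro J B hB he
    change e4gL M n a J ≤ B
    cases J with
    | ten J =>
        exact supNorm_le hB fun p _ => norm_le_of_cube_sups_flat M n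
          (fun p : Fin d × (Tor (fine n M) × Fin d) => grad n M ((DeltaA n M a)⁻¹ *ᵥ divT n M J) p.1 p.2) he p
    | vec J => exact hB
    | ten2 J => exact hB
  hg2_le := by
    intro J α B B' hα0 hα1 hB hB' hh2 he4
    change hg2L M n a J α ≤ 8 * (B + B')
    cases J with
    | ten J =>
        change holderT n M α (grad n M ((DeltaA n M a)⁻¹ *ᵥ divT n M J)) ≤ 8 * (B + B')
        refine holder_global_of_local M n (site := fun p : Fin d × (Tor (fine n M) × Fin d) => p.2.1)
          (sameDir := fun p p' => p.1 = p'.1 ∧ p.2.2 = p'.2.2)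
          (F := fun p => grad n M ((DeltaA n M a)⁻¹ *ᵥ divT n M J) p.1 p.2) hα1 hB hB' (fun y' => hh2 y') fun p => ?_
        exact norm_le_of_cube_sups_flat M n (fun p : Fin d × (Tor (fine n M) × Fin d) =>
          grad n M ((DeltaA n M a)⁻¹ *ᵥ divT n M J) p.1 p.2) he4 p
    | vec J =>
        change (0 : ℝ) ≤ 8 * (B + B')
        positivity
    | ten2 J =>
        change (0 : ℝ) ≤ 8 * (B + B')
        positivity

/-- **p. 36 «The localized inequalities (1.110)–(1.114) imply immediately the following global inequalities» [(1.115)–(1.117)]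
AS A THEOREM FOR THE SETTING OF RECORD**: for every family `i ↦ latticeSettingP12 (n i) (M i) (a i) (k i)` of tori of one dimension `d` with at
least two unit cubes per direction, Proposition 1.2 for the family implies (1.115)–(1.117) for the family (constants chosen before the
instance), with the global Hölder functionals `gP12` — by the tree's `B5Global115.global_of_prop12` with the cover `globCoverP12`, the sign
package `modelSigns_latticeSettingP12` and the row sums `hRow_latticeSettingP12`, all hypothesis-free.
[cite: Balaban1984PropagatorsI, (1.115)–(1.117) p.36] -/
theorem global115_117_of_prop12_latticeSettingP12 {I : Type} (k : I → ℕ) (n : I → ℕ) [∀ i, NeZero (n i)]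
    (M : I → Fin d → ℕ) [∀ i μ, NeZero (M i μ)] (hM2 : ∀ i μ, 2 ≤ M i μ) (a : I → ℝ) :
    B5.Prop12Printed (fun i => latticeSettingP12 (n i) (M i) (a i) (k i)) →
      B5.Global115_117Fam (fun i => latticeSettingP12 (n i) (M i) (a i) (k i)) (fun i => gP12 (M i) (n i) (a i) (k i)) := by
  have h1 : (0 : ℝ) ≤ max 1 (Lw d) := le_max_of_le_left zero_le_one
  have h2 : (0 : ℝ) ≤ Lθ d + 1 := by have := Lθ_nonneg d; positivity
  exact global_of_prop12 (fun i => latticeSettingP12 (n i) (M i) (a i) (k i)) (fun i => gP12 (M i) (n i) (a i) (k i)) h1 h2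
    (fun i => globCoverP12 (M i) (n i) (a i) (hM2 i) (k i)) (fun i => modelSigns_latticeSettingP12 (n i) (M i) (a i) (k i))
    (hRow_latticeSettingP12 k n M a fun i => (Finset.univ : Finset (Tor (M i))))

/-- the single-torus form: ONE torus, `Prop12Printed` of the one-member family gives `Global115_117` for it with the explicit constants of
`B5Global115.global_inst`. [cite: Balaban1984PropagatorsI, (1.115)–(1.117) p.36] -/
theorem global115_117_of_prop12_single (hM2 : ∀ μ, 2 ≤ M μ) (k : ℕ)
    (h : B5.Prop12Printed (fun _ : Unit => latticeSettingP12 n M a k)) :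
    B5.Global115_117Fam (fun _ : Unit => latticeSettingP12 n M a k) (fun _ => gP12 M n a k) :=
  global115_117_of_prop12_latticeSettingP12 (fun _ => k) (fun _ => n) (fun _ => M) (fun _ => hM2) (fun _ => a) h

end Cover

end

end Literature.MathematicalPhysics.QuantumFieldTheory.Balaban1983to89.B5GlobCoverP12Lattice
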